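import Mathlib
import Summits.Ventures.PercRepro2.HCov
import Summits.Ventures.PercRepro2.RootLeafUSigns
import Summits.Ventures.PercRepro2.RootLeafUSecond
import Summits.Ventures.PercRepro2.RootLeafUHalf
import Summits.Ventures.PercRepro2.RootLeafUOu
import Summits.Ventures.PercRepro2.RootLeafUMixL
import Summits.Ventures.PercRepro2.RootLeafUCoinL
import Summits.Ventures.PercRepro2.RootLeafUShareK

/-!
# (MIX-L) from abstract shares: the `o ∈ L` half `0 ≤ T2oL` whenever `b`'s cluster membership on `Q`
is an independent share (blind cell PercRepro2, p4 g16; S3 (G4-u) item (ac); no definitions)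

The mirror of RootLeafUShareK: the coin-class L-side argument of RootLeafUCoinL with the shares
`N·P(Z, b ∈ K) = ρ_K·P(Z)`, `N·P(Z, b ∈ L) = ρ_L·P(Z)` (`Z ∈ {PD, T}` and their `{o ∈ L}`-sections) as
hypotheses, `N·P(Z, b ∈ K)`, `N·P(Z, b ∈ L)` on `T′`, `PD`, `T` for the constant `Λ` (through
`Share.NA_sub_eq`), and `N = 0 ⟹ W = 0`:

* **`N_bracket_eq`**: `N·[(M·W − B₁·Y) − (Y_bK·W − P(R,bK)·Y)] = ρ_L·(Y_t·W − t·Y)`;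
* **`N_OU_add_eq`**: `N·(OU) + (−N·B − 2β·ρ_L)·t = 2·W·Λ`;
* **`mixL_of_shares`**, **`T2oL_nonneg_of_shares`**: (MIX-L) by the two-sign argument `Coin.Lside_alg`,
  hence `0 ≤ T2oL`.
-/

namespace Summit.Ventures.PercRepro2

open UnionCluster CovForm

namespace RootLeafU

namespace Share

variable {V : Type*} {E : Type*} [Fintype E] [DecidableEq E] [Fintype V] [DecidableEq V]
  {R : Type*} [Field R] [LinearOrder R] [IsStrictOrderedRing R]

section LSide

variable (p : E → R) (ends : E → Sym2 V) (o a₂ c b u : V) (N ρK ρL : R)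

omit [Fintype V] [DecidableEq V] [LinearOrder R] [IsStrictOrderedRing R] in
/-- **The mixed bracket collapses**: `N·[(M·W − B₁·Y) − (Y_bK·W − P(R,bK)·Y)] = ρ_L·(Y_t·W − t·Y)`. -/
theorem N_bracket_eq
    (l1 : N * prob p (TEvent ends u a₂ c ∩ (connEvent ends u o ∩ connEvent ends u b)) = ρL * prob p (TEvent ends u a₂ c ∩ connEvent ends u o))
    (l2 : N * prob p (TEvent ends u a₂ c ∩ connEvent ends u b) = ρL * prob p (TEvent ends u a₂ c))
    (l3 : N * prob p (PDEvent ends u a₂ c ∩ (connEvent ends u o ∩ connEvent ends a₂ b)) = ρK * prob p (PDEvent ends u a₂ c ∩ connEvent ends u o))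
    (l4 : N * prob p (TEvent ends u a₂ c ∩ (connEvent ends u o ∩ connEvent ends a₂ b)) = ρK * prob p (TEvent ends u a₂ c ∩ connEvent ends u o))
    (l5 : N * prob p (PDEvent ends u a₂ c ∩ connEvent ends a₂ b) = ρK * prob p (PDEvent ends u a₂ c))
    (l6 : N * prob p (TEvent ends u a₂ c ∩ connEvent ends a₂ b) = ρK * prob p (TEvent ends u a₂ c)) :
    N * ((prob p (TEvent ends u a₂ c ∩ (connEvent ends u o ∩ connEvent ends u b)) * (prob p (PDEvent ends u a₂ c) + prob p (TEvent ends u a₂ c)) - prob p (TEvent ends u a₂ c ∩ connEvent ends u b) * (prob p (PDEvent ends u a₂ c ∩ connEvent ends u o) + prob p (TEvent ends u a₂ c ∩ connEvent ends u o))) - ((prob p (PDEvent ends u a₂ c ∩ (connEvent ends u o ∩ connEvent ends a₂ b)) + prob p (TEvent ends u a₂ c ∩ (connEvent ends u o ∩ connEvent ends a₂ b))) * (prob p (PDEvent ends u a₂ c) + prob p (TEvent ends u a₂ c)) - (prob p (PDEvent ends u a₂ c ∩ connEvent ends a₂ b) + prob p (TEvent ends u a₂ c ∩ connEvent ends a₂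 b)) * (prob p (PDEvent ends u a₂ c ∩ connEvent ends u o) + prob p (TEvent ends u a₂ c ∩ connEvent ends u o)))) =
      ρL * (prob p (TEvent ends u a₂ c ∩ connEvent ends u o) * (prob p (PDEvent ends u a₂ c) + prob p (TEvent ends u a₂ c)) - prob p (TEvent ends u a₂ c) * (prob p (PDEvent ends u a₂ c ∩ connEvent ends u o) + prob p (TEvent ends u a₂ c ∩ connEvent ends u o))) := by
  linear_combination (prob p (PDEvent ends u a₂ c) + prob p (TEvent ends u a₂ c)) * l1 - (prob p (PDEvent ends u a₂ c ∩ connEvent ends u o) + prob p (TEvent ends u a₂ c ∩ connEvent ends u o)) * l2 - (prob p (PDEvent ends u a₂ c) + prob p (TEvent ends u a₂ c)) * (l3 + l4) + (prob p (PDEvent ends u a₂ c ∩ connEvent ends u o) + prob p (TEvent ends u a₂ c ∩ connEvent ends u o)) * (l5 + l6)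

omit [Fintype V] in
/-- **The o-free core and the payer**: `N·(OU) + (−N·B − 2β·ρ_L)·t = 2·W·Λ`. -/
theorem N_OU_add_eq
    (s2 : N * prob p (TEvent ends a₂ u c ∩ connEvent ends a₂ b) = ρK * prob p (TEvent ends a₂ u c))
    (s5 : N * prob p (PDEvent ends u a₂ c ∩ connEvent ends u b) = ρL * prob p (PDEvent ends u a₂ c))
    (s6 : N * prob p (TEvent ends a₂ u c ∩ connEvent ends u b) = ρL * prob p (TEvent ends a₂ u c))
    (s7 : N * prob p (TEvent ends u a₂ c ∩ connEvent ends a₂ b) = ρK * prob p (TEvent ends u a₂ c))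
    (s8 : N * prob p (TEvent ends u a₂ c ∩ connEvent ends u b) = ρL * prob p (TEvent ends u a₂ c))
    (s9 : N * prob p (PDEvent ends u a₂ c ∩ connEvent ends a₂ b) = ρK * prob p (PDEvent ends u a₂ c)) :
    N * T2oL p ends u a₂ c b u +
      (-(N * ((prob p (PDEvent ends u a₂ c) * prob p (connEvent ends a₂ b) + prob p (avoidAll ends a₂ {c}) * gap p ends u a₂ b) - (prob p Set.univ * EQb3 p ends u a₂ c b + prob p Set.univ * PDb p ends u a₂ c b + prob p (connEvent ends a₂ b) * EQ3 p ends u a₂ c + prob p (connEvent ends a₂ b) * prob p (avoidAll ends a₂ {u}) - (prob p Set.univ - prob p (avoidAll ends a₂ {c})) * gap p ends u a₂ b))) -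
        2 * (prob p Set.univ * prob p (PDEvent ends u a₂ c) + prob p (avoidAll ends a₂ {c}) * prob p (avoidAll ends a₂ {u})) * ρL) * prob p (TEvent ends u a₂ c) =
      2 * (prob p (PDEvent ends u a₂ c) + prob p (TEvent ends u a₂ c)) * ((prob p (PDEvent ends u a₂ c) + prob p (TEvent ends a₂ u c)) * (N * prob p (connEvent ends a₂ b) - ρK) + ρL * ((prob p (PDEvent ends u a₂ c) + prob p (TEvent ends a₂ u c)) - prob p (avoidAll ends a₂ {c}) * prob p (avoidAll ends a₂ {u}))) := by
  have hA := NA_sub_eq p ends a₂ c b u N ρK ρL s2 s5 s6 s7 s8 s9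
  unfold T2oL
  simp only [connEvent_self, Set.inter_univ, Set.univ_inter]
  linear_combination (prob p (PDEvent ends u a₂ c) + prob p (TEvent ends u a₂ c)) * hA + 2 * (prob p Set.univ * prob p (PDEvent ends u a₂ c) + prob p (avoidAll ends a₂ {c}) * prob p (avoidAll ends a₂ {u})) * (s8 - s9 - s7)

/-- **(MIX-L) from the shares**: the hypothesis of `MixL.T2oL_nonneg_of_mixL`. -/
theorem mixL_of_shares (hp : IsProbVec p) (hN : 0 ≤ N) (hρL : 0 ≤ ρL)
    (sQ : N * prob p (avoidAll ends a₂ {u} ∩ connEvent ends a₂ b) = ρK * prob p (avoidAll ends a₂ {u}))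
    (s2 : N * prob p (TEvent ends a₂ u c ∩ connEvent ends a₂ b) = ρK * prob p (TEvent ends a₂ u c))
    (s5 : N * prob p (PDEvent ends u a₂ c ∩ connEvent ends u b) = ρL * prob p (PDEvent ends u a₂ c))
    (s6 : N * prob p (TEvent ends a₂ u c ∩ connEvent ends u b) = ρL * prob p (TEvent ends a₂ u c))
    (s7 : N * prob p (TEvent ends u a₂ c ∩ connEvent ends a₂ b) = ρK * prob p (TEvent ends u a₂ c))
    (s8 : N * prob p (TEvent ends u a₂ c ∩ connEvent ends u b) = ρL * prob p (TEvent ends u a₂ c))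
    (s9 : N * prob p (PDEvent ends u a₂ c ∩ connEvent ends a₂ b) = ρK * prob p (PDEvent ends u a₂ c))
    (l1 : N * prob p (TEvent ends u a₂ c ∩ (connEvent ends u o ∩ connEvent ends u b)) = ρL * prob p (TEvent ends u a₂ c ∩ connEvent ends u o))
    (l3 : N * prob p (PDEvent ends u a₂ c ∩ (connEvent ends u o ∩ connEvent ends a₂ b)) = ρK * prob p (PDEvent ends u a₂ c ∩ connEvent ends u o))
    (l4 : N * prob p (TEvent ends u a₂ c ∩ (connEvent ends u o ∩ connEvent ends a₂ b)) = ρK * prob p (TEvent ends u a₂ c ∩ connEvent ends u o))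
    (hN0 : N = 0 → prob p (PDEvent ends u a₂ c) + prob p (TEvent ends u a₂ c) = 0) :
    0 ≤ ((prob p (PDEvent ends u a₂ c) * prob p (connEvent ends a₂ b) + prob p (avoidAll ends a₂ {c}) * gap p ends u a₂ b) - (prob p Set.univ * EQb3 p ends u a₂ c b + prob p Set.univ * PDb p ends u a₂ c b + prob p (connEvent ends a₂ b) * EQ3 p ends u a₂ c + prob p (connEvent ends a₂ b) * prob p (avoidAll ends a₂ {u}) - (prob p Set.univ - prob p (avoidAll ends a₂ {c})) * gap p ends u a₂ b)) * (prob p (TEvent ends u a₂ c ∩ connEvent ends u o) * (prob p (PDEvent ends u a₂ c) + prob p (TEvent ends u a₂ c)) - prob p (TEvent ends u a₂ c) * (prob p (PDEvent ends u a₂ c ∩ connEvent ends u o) + prob p (TEvent ends u a₂ c ∩ connEvent ends u o))) +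
        2 * (prob p Set.univ * prob p (PDEvent ends u a₂ c) + prob p (avoidAll ends a₂ {c}) * prob p (avoidAll ends a₂ {u})) * ((prob p (TEvent ends u a₂ c ∩ (connEvent ends u o ∩ connEvent ends u b)) * (prob p (PDEvent ends u a₂ c) + prob p (TEvent ends u a₂ c)) - prob p (TEvent ends u a₂ c ∩ connEvent ends u b) * (prob p (PDEvent ends u a₂ c ∩ connEvent ends u o) + prob p (TEvent ends u a₂ c ∩ connEvent ends u o))) - ((prob p (PDEvent ends u a₂ c ∩ (connEvent ends u o ∩ connEvent ends a₂ b)) + prob p (TEvent ends u a₂ c ∩ (connEvent ends u o ∩ connEvent ends a₂ b))) * (prob p (PDEvent ends u a₂ c) + prob p (TEvent ends u a₂ c)) - (prob p (PDEvent ends u a₂ c ∩ connEvent ends a₂ b) + prob p (TEvent ends u a₂ c ∩ connEvent ends a₂ b)) * (prob p (PDEvent ends u a₂ c ∩ connEvent ends u o) + prob p (TEvent ends u a₂ c ∩ connEvent ends u o)))) +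
        T2oL p ends u a₂ c b u * (prob p (PDEvent ends u a₂ c ∩ connEvent ends u o) + prob p (TEvent ends u a₂ c ∩ connEvent ends u o)) := by
  have hBr := N_bracket_eq p ends o a₂ c b u N ρK ρL l1 s8 l3 l4 s9 s7
  have hOU := N_OU_add_eq p ends a₂ c b u N ρK ρL s2 s5 s6 s7 s8 s9
  have hL := Lam_nonneg p ends a₂ c b u N ρK ρL hp hN hρL sQ
  have hOUnn := T2oL_root_nonneg p ends a₂ c b u hp
  have hδ := ToL_mul_D_le p hp ends o u a₂ c
  rcases hN.lt_or_eq with hpos | hzero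
  · exact Coin.Lside_alg hpos hBr hOU hL hOUnn hδ (prob_nonneg hp _) (prob_nonneg hp _)
      (prob_nonneg hp _) (prob_nonneg hp _)
  · -- `N = 0`: every `PD`/`T` mass vanishes
    have h0 := hN0 hzero.symm
    have hD := prob_nonneg hp (PDEvent ends u a₂ c)
    have ht := prob_nonneg hp (TEvent ends u a₂ c)
    have z : ∀ X : Set (Config E), prob p (PDEvent ends u a₂ c ∩ X) = 0 ∧ prob p (TEvent ends u a₂ c ∩ X) = 0 := by
      intro X
      have hDX := prob_inter_le_left hp (PDEvent ends u a₂ c) X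
      have hTX := prob_inter_le_left hp (TEvent ends u a₂ c) X
      have hDX0 := prob_nonneg hp (PDEvent ends u a₂ c ∩ X)
      have hTX0 := prob_nonneg hp (TEvent ends u a₂ c ∩ X)
      constructor <;> linarith
    have hD0 : prob p (PDEvent ends u a₂ c) = 0 := by linarith
    have ht0 : prob p (TEvent ends u a₂ c) = 0 := by linarith
    rw [(z (connEvent ends u o)).1, (z (connEvent ends u o)).2,
      (z (connEvent ends u o ∩ connEvent ends u b)).2, (z (connEvent ends u b)).2,
      (z (connEvent ends u o ∩ connEvent ends a₂ b)).1, (z (connEvent ends u o ∩ connEvent ends a₂ b)).2,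
      (z (connEvent ends a₂ b)).1, (z (connEvent ends a₂ b)).2, hD0, ht0]
    simp

/-- **`0 ≤ T2oL` from the shares.** -/
theorem T2oL_nonneg_of_shares (hp : IsProbVec p) (hN : 0 ≤ N) (hρL : 0 ≤ ρL)
    (sQ : N * prob p (avoidAll ends a₂ {u} ∩ connEvent ends a₂ b) = ρK * prob p (avoidAll ends a₂ {u}))
    (s2 : N * prob p (TEvent ends a₂ u c ∩ connEvent ends a₂ b) = ρK * prob p (TEvent ends a₂ u c))
    (s5 : N * prob p (PDEvent ends u a₂ c ∩ connEvent ends u b) = ρL * prob p (PDEvent ends u a₂ c))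
    (s6 : N * prob p (TEvent ends a₂ u c ∩ connEvent ends u b) = ρL * prob p (TEvent ends a₂ u c))
    (s7 : N * prob p (TEvent ends u a₂ c ∩ connEvent ends a₂ b) = ρK * prob p (TEvent ends u a₂ c))
    (s8 : N * prob p (TEvent ends u a₂ c ∩ connEvent ends u b) = ρL * prob p (TEvent ends u a₂ c))
    (s9 : N * prob p (PDEvent ends u a₂ c ∩ connEvent ends a₂ b) = ρK * prob p (PDEvent ends u a₂ c))
    (l1 : N * prob p (TEvent ends u a₂ c ∩ (connEvent ends u o ∩ connEvent ends u b)) = ρL * prob p (TEvent ends u a₂ c ∩ connEvent ends u o))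
    (l3 : N * prob p (PDEvent ends u a₂ c ∩ (connEvent ends u o ∩ connEvent ends a₂ b)) = ρK * prob p (PDEvent ends u a₂ c ∩ connEvent ends u o))
    (l4 : N * prob p (TEvent ends u a₂ c ∩ (connEvent ends u o ∩ connEvent ends a₂ b)) = ρK * prob p (TEvent ends u a₂ c ∩ connEvent ends u o))
    (hN0 : N = 0 → prob p (PDEvent ends u a₂ c) + prob p (TEvent ends u a₂ c) = 0) :
    0 ≤ T2oL p ends o a₂ c b u :=
  MixL.T2oL_nonneg_of_mixL p ends o a₂ c b u hp
    (mixL_of_shares p ends o a₂ c b u N ρK ρL hp hN hρL sQ s2 s5 s6 s7 s8 s9 l1 l3 l4 hN0)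

end LSide

end Share

end RootLeafU

end Summit.Ventures.PercRepro2
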